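import Summits.Schanuel.Schanuel.Theorems.RootDecomp1KXAll04

/-!
# RootDecomp1KXAll — lens 1, generation 46, node 5 «ALL CURVES: ThinFibreAt m₀ P for EVERY P ∈ ℤ[x][Y], P ≠ 0, at every m₀ ≥ thinThreshold P = max(3, 2·μ(P)+1, e(P)+1)» (CLAIM L2336, PRICE + CHECKLIST K-g46 L2337, NODE L2353, critic VERDICT L2357: CLEARED THEOREM ×1 under K-R35 — the last threshold-THEOREM of the K-line, UNCONDITIONAL; PORT GO L2357) — continuation (RootDecomp1KXAll05): §XIV.8 (first half) thresholds of xPolyP, specialisations by name, multiplicity bounds, P₃-family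

(lens-1 g46 HOME kernel K₅ = HOME/decomp-schanuel-lens-1/g46/XAll.lean 4f432885…, 1310 l, ONE import …RootDecomp1KXTop03; P₅/C₅ + NODE-g46.md. Port by census-1 gen 20 as `RootDecomp1KXAll01–06` (the memo's 01–05 split with §XIV.8 cut in two by the 400-line cap): 01 = private helper copies + §XIV.1 roots with multiplicity in `ℂ₂` and the nearest-root lemma without separability (`roots_data_mult`, `nearest_root_mult`, `rootMultiplicity_le_one_of_separable`, `rootMultiplicity_le_natDegree'`) + §XIV.2 Ridout for rationals with exponent `κ = a/b > 2` (`ridout_one_pow`, `ridout_window_pow`; tree `Ridout.finite_of_abs_le_one` BY NAME, called once); 02 = §XIV.3 the dichotomy with multiplicity (`near_root_or_at_infinity_mult`) + §XIV.4 its arithmetic end (`dichotomy_arith_mult`); 03 = §XIV.5 THE PARAMETRIC THEOREM `thinFibreAt_xPoly_mult` (+ `_claim`, `_again` private, `_crude`) + §XIV.6 every `P ∈ ℤ[x][Y]` (`xCoeff`, `topX`, `eTop`, `muTop`, `thinThreshold`, `xPolyP_xCoeff`, **`thinFibreAt_all`**, `thinFibreAt_effective`); 04 = §XIV.7 CONSUMER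 for all x-degrees (`xCoeff_dX`, …, `thinThreshold_dX_le`, `no_relation_of_closed_class`, `allCurves_nonvanishing`); 05 = §XIV.8 thresholds of `xPolyP k c` in the data `(μ, e)`, specialisations BY NAME (examples against tree `…XTop.thinFibreAt_xPoly`, `…XLinearII.thinFibreAt_xLinear_sep`, `ridout_window`, `dichotomy_arith`), root-multiplicity bounds, the P₃-family `thinFibreAt_purePowerTop`; 06 = members P₁ P₂ P₃ with thresholds 5 / 7 / 5 proved as theorems + CONSUMER at the members.
PORT EDITS (sanctioned in VERDICT L2357 (a)–(e)): `set_option linter.dupNamespace false` dropped; `thinFibreAt_xPoly_again` and `thinFibreAt_xLinear_sep_again` (type-twins of tree `…XTop.thinFibreAt_xPoly` / `…XLinearII.thinFibreAt_xLinear_sep`) made `private` (dedup); per-part private helper copies; the two scoped `set_option maxHeartbeats 400000 in` kept as in K₅; `example` blocks kept; 19 one-line docstrings added (gate lint.docstring); statements and proofs otherwise verbatim. `--supports stmt-Schanuel-33364`; no census credit carried; rung 0 — nothing here proves Schanuel; no ∀-item of 1K moves.)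
-/

noncomputable section

namespace Summit.Schanuel.Schanuel.Theorems.RootDecomp1KXAll

open Polynomial LiouvilleNumber
open scoped Nat
open Summit.Schanuel.Schanuel.Theorems.RootDecomp1KSkelCell
  (exists_le_two_pow_factorial iota iota_spec iota_le_of_le pow_lt_of_lt_iota lt_iota_of_pow_lt iota_mono
   one_le_iota SkelLiouville SkelLiouvilleFix skelLiouville_iff_fix SkelLiouvilleFix.mono uStar dU rU dU_cast
   two_pow_le_four_mul_dU two_mul_dU_lt one_le_dU rU_den rU_cast uStar_sub_rU skelLiouvilleFix_one_uStar
   not_skelFixOne_algebraicIndependent)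
open Summit.Schanuel.Schanuel.Theorems.RootDecomp1KTwoBaseCell (psNumer partialSum_eq_psNumer_div coprime_psNumer
  algebraicIndependent_of_forall_int')
open Summit.Schanuel.Schanuel.Theorems.RootDecomp1KRelLiouvilleCell (partialSum_two_strictMono
  partialSum_two_lt_liouvilleNumber abs_liouvilleNumber_two_sub_partialSum)
open Summit.Schanuel.Schanuel.Theorems.RootDecomp1KDegreeLadder
open Summit.Schanuel.Schanuel.Theorems.RootDecomp1KXLinearCore
open Summit.Schanuel.Schanuel.Theorems.RootDecomp1KXLinear
open Summit.Schanuel.Schanuel.Theorems.RootDecomp1KXLinearII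
open Summit.Schanuel.Schanuel.Theorems.RootDecomp1KXTop

/-- `μ = 1`: node 4 (g45d) `thinFibreAt_xPoly` RE-DERIVED ON THE NOSE — separable top coefficient, every
`m₀ ≥ max(3, e + 1)`. -/
private theorem thinFibreAt_xPoly_again (k : ℕ) (c : ℕ → ℤ[X]) (e : ℕ)
    (hsep : ((c k).map (Int.castRingHom ℚ)).Separable) (hdeg : ∀ j, j < k → (c j).natDegree ≤ (c k).natDegree + e)
    {m₀ : ℕ} (hm : 3 ≤ m₀) (hme : e + 1 ≤ m₀) : ThinFibreAt m₀ (xPolyP k c) := by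
  have hB : c k ≠ 0 := by
    intro h
    rw [h, Polynomial.map_zero] at hsep
    exact not_separable_zero hsep
  exact thinFibreAt_xPoly_mult k c e 1 hB le_rfl (rootMultiplicity_le_one_of_separable (c k) hsep) hdeg
    (by omega) hme

/-! ## §XIV.8  The threshold of `xPolyP k c` in the data `(μ, e)`; specialisations by name; members and positions -/

/-- the `x`-coefficients of `xPolyP k c` are the `c_j`. -/
theorem xCoeff_xPolyP (k : ℕ) (c : ℕ → ℤ[X]) (j : ℕ) : xCoeff (xPolyP k c) j = if j ≤ k then c j else 0 := by
  ext i
  rw [coeff_xCoeff, coeff_coeff_xPolyP]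
  simp only [Finset.mem_range, Nat.lt_succ_iff]
  split_ifs <;> simp

/-- `xdeg (xPolyP k c) ≤ k`. -/
theorem xdeg_xPolyP_le (k : ℕ) (c : ℕ → ℤ[X]) : xdeg (xPolyP k c) ≤ k := by
  unfold xdeg
  refine Finset.sup_le fun i _ => ?_
  rw [coeff_xPolyP]
  refine (natDegree_sum_le _ _).trans (Finset.sup_le fun j hj => ?_)
  exact (natDegree_C_mul_X_pow_le _ _).trans (by have := Finset.mem_range.mp hj; omega)

/-- `xdeg (xPolyP k c) = k` when `c k ≠ 0`. -/
theorem xdeg_xPolyP (k : ℕ) (c : ℕ → ℤ[X]) (hk : c k ≠ 0) : xdeg (xPolyP k c) = k := by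
  refine le_antisymm (xdeg_xPolyP_le k c) (le_xdeg_of_xCoeff_ne_zero ?_)
  rw [xCoeff_xPolyP, if_pos le_rfl]
  exact hk

/-- `topX (xPolyP k c) = c k` when `c k ≠ 0`. -/
theorem topX_xPolyP (k : ℕ) (c : ℕ → ℤ[X]) (hk : c k ≠ 0) : topX (xPolyP k c) = c k := by
  unfold topX
  rw [xdeg_xPolyP k c hk, xCoeff_xPolyP, if_pos le_rfl]

/-- `deg_Y (xPolyP k c) ≤ d` when every `c j`, `j ≤ k`, has degree `≤ d`. -/
theorem natDegree_xPolyP_le (k : ℕ) (c : ℕ → ℤ[X]) (d : ℕ) (h : ∀ j, j ≤ k → (c j).natDegree ≤ d) :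
    (xPolyP k c).natDegree ≤ d := by
  unfold xPolyP
  refine (natDegree_sum_le _ _).trans (Finset.sup_le fun j hj => ?_)
  have hj' : j ≤ k := Nat.lt_succ_iff.mp (Finset.mem_range.mp hj)
  calc (C (X ^ j) * Polynomial.map C (c j)).natDegree ≤ (Polynomial.map C (c j)).natDegree := natDegree_C_mul_le _ _
    _ ≤ (c j).natDegree := natDegree_map_le
    _ ≤ d := h j hj'

/-- `eTop (xPolyP k c) ≤ e` when the lower coefficients exceed `deg (c k)` by at most `e`. -/
theorem eTop_xPolyP_le (k : ℕ) (c : ℕ → ℤ[X]) (e : ℕ) (hk : c k ≠ 0)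
    (hdeg : ∀ j, j < k → (c j).natDegree ≤ (c k).natDegree + e) : eTop (xPolyP k c) ≤ e := by
  unfold eTop
  rw [topX_xPolyP k c hk]
  have := natDegree_xPolyP_le k c ((c k).natDegree + e) (fun j hj => by
    rcases Nat.lt_or_ge j k with h | h
    · exact hdeg j h
    · have : j = k := le_antisymm hj h
      subst this; omega)
  omega

/-- `muTop (xPolyP k c) ≤ μ` when every root of `c k` in `ℂ₂` has multiplicity `≤ μ`. -/
theorem muTop_xPolyP_le (k : ℕ) (c : ℕ → ℤ[X]) (μ : ℕ) (hk : c k ≠ 0)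
    (hmult : ∀ β : PadicAlgCl 2, rootMultiplicity β ((c k).map (algebraMap ℤ (PadicAlgCl 2))) ≤ μ) :
    muTop (xPolyP k c) ≤ μ := by
  classical
  unfold muTop
  rw [topX_xPolyP k c hk]
  exact Finset.sup_le fun β _ => hmult β

/-- **the threshold of `xPolyP k c`** in the data `(μ, e)`: `thinThreshold ≤ max(3, 2μ+1, e+1)` — so
`thinFibreAt_all` CONTAINS `thinFibreAt_xPoly_mult` (and conversely is proved from it). -/
theorem thinThreshold_xPolyP_le (k : ℕ) (c : ℕ → ℤ[X]) (e μ : ℕ) (hk : c k ≠ 0)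
    (hmult : ∀ β : PadicAlgCl 2, rootMultiplicity β ((c k).map (algebraMap ℤ (PadicAlgCl 2))) ≤ μ)
    (hdeg : ∀ j, j < k → (c j).natDegree ≤ (c k).natDegree + e) :
    thinThreshold (xPolyP k c) ≤ max 3 (max (2 * μ + 1) (e + 1)) := by
  unfold thinThreshold
  have h1 := muTop_xPolyP_le k c μ hk hmult
  have h2 := eTop_xPolyP_le k c e hk hdeg
  omega

/-- consistency: the parametric theorem as an INSTANCE of `thinFibreAt_all` (no `hμ` needed this way round). -/
theorem thinFibreAt_xPoly_mult' (k : ℕ) (c : ℕ → ℤ[X]) (e μ : ℕ) (hB : c k ≠ 0)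
    (hmult : ∀ β : PadicAlgCl 2, rootMultiplicity β ((c k).map (algebraMap ℤ (PadicAlgCl 2))) ≤ μ)
    (hdeg : ∀ j, j < k → (c j).natDegree ≤ (c k).natDegree + e)
    {m₀ : ℕ} (h3 : 3 ≤ m₀) (hm : 2 * μ + 1 ≤ m₀) (hme : e + 1 ≤ m₀) : ThinFibreAt m₀ (xPolyP k c) := by
  refine thinFibreAt_all _ ?_ ((thinThreshold_xPolyP_le k c e μ hB hmult hdeg).trans (by omega))
  intro h0
  apply hB
  have := topX_xPolyP k c hB
  rw [h0] at this
  rw [← this]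
  unfold topX xCoeff
  simp

/-! ### Specialisations BY NAME (checklist K-g46 (3), (4)) -/

/-- (3a) `μ = 1`: the tree's (node 4, g45d) `thinFibreAt_xPoly` statement, re-derived on the nose. -/
example : ∀ (k : ℕ) (c : ℕ → ℤ[X]) (e : ℕ), ((c k).map (Int.castRingHom ℚ)).Separable →
    (∀ j, j < k → (c j).natDegree ≤ (c k).natDegree + e) → ∀ {m₀ : ℕ}, 3 ≤ m₀ → e + 1 ≤ m₀ →
    ThinFibreAt m₀ (xPolyP k c) :=
  fun k c e hsep hdeg _ hm hme => thinFibreAt_xPoly_again k c e hsep hdeg hm hme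

/-- … and the tree decl has literally that type. -/
example : ∀ (k : ℕ) (c : ℕ → ℤ[X]) (e : ℕ), ((c k).map (Int.castRingHom ℚ)).Separable →
    (∀ j, j < k → (c j).natDegree ≤ (c k).natDegree + e) → ∀ {m₀ : ℕ}, 3 ≤ m₀ → e + 1 ≤ m₀ →
    ThinFibreAt m₀ (xPolyP k c) :=
  fun k c e hsep hdeg _ hm hme => thinFibreAt_xPoly k c e hsep hdeg hm hme

/-- (3b) `k = 1`: the tree's (node 3, g45c) `thinFibreAt_xLinear_sep` statement, re-derived through `xPolyP_one`. -/
private theorem thinFibreAt_xLinear_sep_again (A B : ℤ[X]) (hsep : (B.map (Int.castRingHom ℚ)).Separable)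
    (hle : A.natDegree ≤ B.natDegree) {m₀ : ℕ} (hm : 3 ≤ m₀) : ThinFibreAt m₀ (xLinP A B) := by
  have h := thinFibreAt_xPoly_again 1 (fun j => if j = 0 then A else B) 0 (by simpa using hsep)
    (fun j hj => by
      have : j = 0 := by omega
      subst this; simpa using hle) hm (by omega)
  rwa [xPolyP_one] at h

example : ∀ (A B : ℤ[X]), (B.map (Int.castRingHom ℚ)).Separable → A.natDegree ≤ B.natDegree →
    ∀ {m₀ : ℕ}, 3 ≤ m₀ → ThinFibreAt m₀ (xLinP A B) :=
  fun A B hsep hle _ hm => thinFibreAt_xLinear_sep A B hsep hle hm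

/-- (3c) `k = 1` with a NON-separable `B` of root multiplicity `≤ μ`: outside nodes 2–4, every `m₀ ≥ max(3, 2μ+1, e+1)`. -/
theorem thinFibreAt_xLinear_mult (A B : ℤ[X]) (hB : B ≠ 0) (e μ : ℕ) (hμ : 1 ≤ μ)
    (hmult : ∀ β : PadicAlgCl 2, rootMultiplicity β (B.map (algebraMap ℤ (PadicAlgCl 2))) ≤ μ)
    (hle : A.natDegree ≤ B.natDegree + e) {m₀ : ℕ} (hm : 2 * μ + 1 ≤ m₀) (hme : e + 1 ≤ m₀) :
    ThinFibreAt m₀ (xLinP A B) := by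
  have h := thinFibreAt_xPoly_mult 1 (fun j => if j = 0 then A else B) e μ (by simpa using hB) hμ
    (by simpa using hmult) (fun j hj => by
      have : j = 0 := by omega
      subst this; simpa using hle) hm hme
  rwa [xPolyP_one] at h

/-- (4a) `ridout_window_pow` at `(a, b) = (5, 2)` is the tree's `ridout_window` (node 3 port, XLinearII01). -/
example (B : ℤ[X]) (hb : 1 ≤ B.natDegree) (C : ℝ) :
    {r : ℚ | |(r : ℝ)| ≤ C ∧ ∃ β : PadicAlgCl 2, aeval β B = 0 ∧
      (r.den : ℝ) ^ 5 * ‖(B.leadingCoeff : PadicAlgCl 2) * ((r : PadicAlgCl 2) - β)‖ ^ 2 ≤ 1}.Finite :=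
  ridout_window_pow B hb C 5 2 (by norm_num) (by norm_num)

example (B : ℤ[X]) (hb : 1 ≤ B.natDegree) (C : ℝ) :
    {r : ℚ | |(r : ℝ)| ≤ C ∧ ∃ β : PadicAlgCl 2, aeval β B = 0 ∧
      (r.den : ℝ) ^ 5 * ‖(B.leadingCoeff : PadicAlgCl 2) * ((r : PadicAlgCl 2) - β)‖ ^ 2 ≤ 1}.Finite :=
  ridout_window B hb C

/-- (4b) `dichotomy_arith_mult 1` is the tree's `dichotomy_arith` LITERALLY (XLinearII02). -/
example (c C : ℝ) : ∃ N₂ : ℕ, ∀ N, N₂ ≤ N → ∀ (d : ℕ) (x : ℝ), 1 ≤ d → 0 ≤ x →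
    x ≤ c * (1 / 2 : ℝ) ^ N ! → ¬ ((d : ℝ) ^ 5 * x ^ 2 ≤ 1) → C * 2 ^ (N + 1)! < (d : ℝ) ^ (3 * N) := by
  obtain ⟨N₂, h⟩ := dichotomy_arith_mult 1 c C
  exact ⟨N₂, fun N hN d x hd hx0 hx hnot => by
    simpa using h N hN d x hd hx0 (by simpa using hx) (by simpa using hnot)⟩

example (c C : ℝ) : ∃ N₂ : ℕ, ∀ N, N₂ ≤ N → ∀ (d : ℕ) (x : ℝ), 1 ≤ d → 0 ≤ x →
    x ≤ c * (1 / 2 : ℝ) ^ N ! → ¬ ((d : ℝ) ^ 5 * x ^ 2 ≤ 1) → C * 2 ^ (N + 1)! < (d : ℝ) ^ (3 * N) :=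
  dichotomy_arith c C

/-- (4c) `nearest_root_mult` at `μ = 1` gives back the separable `nearest_root` shape up to `min 1`. -/
example (B : ℤ[X]) (hb : 1 ≤ B.natDegree) (hsep : (B.map (Int.castRingHom ℚ)).Separable) :
    ∃ (T : Finset (PadicAlgCl 2)) (c : ℝ), 0 < c ∧ (∀ β ∈ T, aeval β B = 0) ∧
      ∀ z : PadicAlgCl 2, ∃ β ∈ T, min 1 ‖z - β‖ ≤ c * ‖aeval z B‖ := by
  obtain ⟨T, n, c, hc, hroots, -, -, hnear⟩ := nearest_root_mult B hb 1 (rootMultiplicity_le_one_of_separable B hsep)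
  exact ⟨T, c, hc, hroots, fun z => by simpa using hnear z⟩

/-! ### Root-multiplicity bounds for explicit top coefficients -/

/-- pure powers: every root of `(X − a)^μ` has multiplicity `≤ μ`. -/
theorem rootMultiplicity_X_sub_C_pow_le (a : PadicAlgCl 2) (μ : ℕ) (β : PadicAlgCl 2) :
    rootMultiplicity β ((X - C a) ^ μ) ≤ μ := by
  classical
  by_cases h : β = a
  · rw [h, rootMultiplicity_X_sub_C_pow]
  · rw [rootMultiplicity_eq_zero]
    · exact Nat.zero_le _
    · rw [IsRoot.def, eval_pow, eval_sub, eval_X, eval_C]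
      exact pow_ne_zero _ (sub_ne_zero.mpr h)

/-- powers of a separable polynomial: multiplicities `≤ μ`. -/
theorem rootMultiplicity_pow_le_of_separable (q : (PadicAlgCl 2)[X]) (hsep : q.Separable) (μ : ℕ)
    (β : PadicAlgCl 2) : rootMultiplicity β (q ^ μ) ≤ μ := by
  classical
  rw [← count_roots, roots_pow, Multiset.count_nsmul]
  have := count_roots_le_one hsep β
  calc μ * q.roots.count β ≤ μ * 1 := Nat.mul_le_mul_left _ this
    _ = μ := mul_one _

/-- a non-zero constant factor does not change multiplicities. -/
theorem rootMultiplicity_C_mul_eq (a : PadicAlgCl 2) (ha : a ≠ 0) (q : (PadicAlgCl 2)[X]) (β : PadicAlgCl 2) :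
    rootMultiplicity β (C a * q) = rootMultiplicity β q := by
  by_cases hq : q = 0
  · rw [hq, mul_zero]
  · rw [rootMultiplicity_mul (mul_ne_zero (C_ne_zero.mpr ha) hq), rootMultiplicity_C, zero_add]

/-! ### P₃-FAMILY: pure-power top coefficient `(Y − a)^μ` -/

/-- **pure-power top**: `c_k = (Y − a)^μ` (`μ ≥ 1`, NOT separable for `μ ≥ 2`), lower coefficients of degree
`≤ μ + e`: `ThinFibreAt m₀` for every `m₀ ≥ max(3, 2μ+1, e+1)`. -/
theorem thinFibreAt_purePowerTop (k : ℕ) (c : ℕ → ℤ[X]) (a : ℤ) (μ e : ℕ) (hμ : 1 ≤ μ)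
    (htop : c k = (X - C a) ^ μ) (hdeg : ∀ j, j < k → (c j).natDegree ≤ μ + e)
    {m₀ : ℕ} (hm : 2 * μ + 1 ≤ m₀) (hme : e + 1 ≤ m₀) : ThinFibreAt m₀ (xPolyP k c) := by
  have hB : c k ≠ 0 := by rw [htop]; exact pow_ne_zero _ (X_sub_C_ne_zero a)
  have hd : (c k).natDegree = μ := by rw [htop, natDegree_pow, natDegree_X_sub_C, mul_one]
  refine thinFibreAt_xPoly_mult k c e μ hB hμ (fun β => ?_) (fun j hj => by rw [hd]; exact hdeg j hj) hm hme
  rw [htop, Polynomial.map_pow, Polynomial.map_sub, map_X, map_C]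
  exact rootMultiplicity_X_sub_C_pow_le _ μ β

end Summit.Schanuel.Schanuel.Theorems.RootDecomp1KXAll

end
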